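import Summits.BirchSwinnertonDyer.BirchSwinnertonDyer.Theorems.ClassRecordThreeEulerHalvesAtThreeCartanSupplyNormOneElliptic
import Summits.BirchSwinnertonDyer.BirchSwinnertonDyer.Theorems.ClassRecordThreeEulerHalvesAtThreeCartanSupplyCubicClasses
import HarnessLib

/-!
# TRANSPORT behind NUM, brick F: two non-split Cartan residue fields of `M₂(𝔽_q)` are conjugate by a matrix of determinant ONE

Helper file `--supports stmt-BirchSwinnertonDyer-19109 --as helper` (seat `bsd-idea-10` g17, lens transfer; crux `EulerHalvesAtThree` ∕ residue crux
23422 line `cartan`, the one open node (F2b♮) ⟺ NUM `CartanCorrespondence.CartanOnePlaceDegreeLawAtThree`; road memo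
`Cruxes/EulerHalvesAtThree/TRANSPORT-HULL.md` §3.6, brick F of the general-`C` presentation independence `CartanDegreeIndep` by hull transfer).
NUM quantifies over ARBITRARY presentations `X`, `X'`; transporting a Cartan order onto another inside ONE Eichler hull is done by a norm-one hull
unit whose residue at each Cartan prime `p` conjugates the residue field `k'_p = 𝔽_p[η']` onto `k_p = 𝔽_p[η]`; the residues of norm-one units have
determinant `1`, whence the determinant-one requirement. THIS FILE (all PROVED, `q` any prime, `η, η'` without rational eigenvalue):
* §1 `trace_det_of_two` — at `q = 2` a matrix without rational eigenvalue has `(tr, det) = (1, 1)`;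
* §2 `exists_lin_det_eq` — the norm form of `𝔽_q[η]` represents every unit: `det(a·1 + b·η) = e` is solvable for `e ≠ 0` (odd `q`: complete the
  square and Mathlib `FiniteField.exists_root_sum_quadratic`; `q = 2`: `e = 1`);
* §3 **`exists_det_one_conj_eq_lin`** — there is `y ∈ GL₂(𝔽_q)` with `det y = 1` and `y⁻¹ η' y = a·1 + b·η`, `b ≠ 0` (odd `q`: the tree's
  `card_nonsplitTorus_conj_of_elliptic` — an elliptic element has exactly two conjugates in `T_η`; `q = 2`: `η` itself by `exists_conj_units`; then the
  determinant is corrected inside the torus `T_η` by §2);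
* §4 `conj_lin`, **`exists_det_one_conj_field`** — hence `y⁻¹ 𝔽_q[η'] y = 𝔽_q[η]` elementwise in both directions, and the membership transport
  `conj_mem_field_iff` consumed by the pinning step of the assembly.
HONEST FRAMING: finite-field bookkeeping only (one brick of seven); nothing about NUM, crux 23422 ∕ 19109 or any summit statement is proved by this
seat; BSD is proved for no curve. [folklore]
-/

set_option linter.dupNamespace false
set_option autoImplicit false

noncomputable section

namespace Summit.BirchSwinnertonDyer.BirchSwinnertonDyer.Theorems.CartanTransport.ResidueField

open Summit.BirchSwinnertonDyer.BirchSwinnertonDyer.Theorems.CartanDegree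
open Summit.BirchSwinnertonDyer.BirchSwinnertonDyer.Theorems.CartanTorusCubeCut
open Summit.BirchSwinnertonDyer.BirchSwinnertonDyer.Theorems.CartanSupply.NormOne
open Summit.BirchSwinnertonDyer.BirchSwinnertonDyer.Theorems.CartanSupply
open scoped Classical
open Polynomial

variable {q : ℕ} [Fact q.Prime]

/-! ## §1 The prime `2` -/

/-- PROVED: over `𝔽₂` the only quadratic `x² + t x + d` without a root is `x² + x + 1` (four cases). [folklore] -/
theorem zmod_two_no_root : ∀ t d : ZMod 2, (¬ ∃ x : ZMod 2, x * x + d = t * x) → t = 1 ∧ d = 1 := by decide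

/-- PROVED: the only unit of `𝔽₂` is `1`. [folklore] -/
theorem zmod_two_eq_one : ∀ e : ZMod 2, e ≠ 0 → e = 1 := by decide

/-- PROVED: over `𝔽₂` a matrix without rational eigenvalue has trace `1` and determinant `1`. [folklore] -/
theorem trace_det_of_two (hq2 : q = 2) {M : Mat q} (hM : ¬ HasRatEigenvalue M) : M.trace = 1 ∧ M.det = 1 := by
  subst hq2
  exact zmod_two_no_root M.trace M.det fun h => hM h

/-! ## §2 The norm form of `𝔽_q[η]` represents every unit -/

/-- PROVED — **`det(a·1 + b·η) = e` is solvable for every `e ≠ 0`** (`η` without rational eigenvalue). Odd `q`: `4·det(a·1 + b·η) = (2a + b·tr η)² − b²Δ_η`,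
and `x² − Δ_η b² = 4e` has a solution by the pigeonhole count of values of two quadratics (Mathlib `FiniteField.exists_root_sum_quadratic`); `q = 2`:
`e = 1 = det 1`. (Surjectivity of the norm `𝔽_{q²}^× → 𝔽_q^×`, in matrix dress.) [folklore] -/
theorem exists_lin_det_eq {η : Mat q} (hη : ¬ HasRatEigenvalue η) {e : ZMod q} (he : e ≠ 0) :
    ∃ p : ZMod q × ZMod q, p ≠ 0 ∧ (lin η p).det = e := by
  have hp_of_det : ∀ p : ZMod q × ZMod q, (lin η p).det = e → p ≠ 0 := by
    rintro p hp rfl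
    apply he
    rw [← hp, det_lin]
    simp
  by_cases hq2 : q = 2
  · have he1 : e = 1 := by
      subst hq2
      exact zmod_two_eq_one e he
    refine ⟨(1, 0), hp_of_det _ ?_, ?_⟩ <;> rw [det_lin, he1] <;> simp
  · have hodd : Fintype.card (ZMod q) % 2 = 1 := by
      rw [ZMod.card]
      exact Nat.odd_iff.mp ((Fact.out : q.Prime).odd_of_ne_two hq2)
    have hΔ0 : η.trace ^ 2 - 4 * η.det ≠ 0 := PS.discr_ne_zero_of_not_hasRatEigenvalue hq2 hη
    have hf : degree (C (1 : ZMod q) * X ^ 2 + C 0 * X + C 0) = 2 := degree_quadratic one_ne_zero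
    have hg : degree (C (-(η.trace ^ 2 - 4 * η.det)) * X ^ 2 + C 0 * X + C (-(4 * e))) = 2 :=
      degree_quadratic (neg_ne_zero.mpr hΔ0)
    obtain ⟨a, b, hab⟩ := FiniteField.exists_root_sum_quadratic hf hg hodd
    simp only [eval_add, eval_mul, eval_C, eval_pow, eval_X] at hab
    have hb : b ^ 2 * (η.trace ^ 2 - 4 * η.det) = a ^ 2 - 4 * e := by linear_combination -hab
    refine ⟨((a - b * η.trace) * 2⁻¹, b), hp_of_det _ (lin_point hq2 η a e b hb).2, (lin_point hq2 η a e b hb).2⟩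

/-! ## §3 A conjugator of determinant one -/

/-- PROVED: two elements of `𝔽_q[η]` commute (tree `lin_mul_lin`, `pmul_comm`). [folklore] -/
theorem lin_mul_comm (η : Mat q) (p p' : ZMod q × ZMod q) : lin η p * lin η p' = lin η p' * lin η p := by
  rw [lin_mul_lin, lin_mul_lin, pmul_comm]

/-- PROVED — **CONJUGATING `η'` INTO `𝔽_q[η]` WITH DETERMINANT ONE**: for `η, η'` without rational eigenvalue there is `y ∈ GL₂(𝔽_q)`, `det y = 1`, with
`y⁻¹ η' y = a·1 + b·η`, `b ≠ 0`. Odd `q`: `η'` is elliptic, so it has (exactly two) conjugates in the non-split torus `T_η` (tree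
`card_nonsplitTorus_conj_of_elliptic`); `q = 2`: `(tr, det) = (1, 1)` for both, so `η` is a conjugate of `η'` (tree `exists_conj_units`); in both cases the
conjugator `y₀` is replaced by `y₀ c`, `c ∈ T_η` with `det c = (det y₀)⁻¹` (§2), which does not move the conjugate. [folklore] -/
theorem exists_det_one_conj_eq_lin {η η' : Mat q} (hη : ¬ HasRatEigenvalue η) (hη' : ¬ HasRatEigenvalue η') :
    ∃ y : G q, (y : Mat q).det = 1 ∧ ∃ p₀ : ZMod q × ZMod q, p₀.2 ≠ 0 ∧
      ((y⁻¹ : G q) : Mat q) * η' * (y : Mat q) = lin η p₀ := by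
  have h01 : ((0 : ZMod q), (1 : ZMod q)) ≠ 0 := by simp
  set g : G q := linGL η' hη' (0, 1) with hg
  have hgcoe : (g : Mat q) = η' := by
    rw [hg, linGL_coe hη' h01]
    simp [lin]
  have hgns : ¬ IsScalarMat (g : Mat q) := by
    rw [hgcoe]
    exact fun hs => hη' (hasRatEigenvalue_of_isScalarMat hs)
  -- steps 1–2: a conjugate of `g` in the torus `T_η`
  obtain ⟨x, hxT, y₀, hy₀⟩ : ∃ x ∈ nonsplitTorus η, ∃ y₀ : G q, y₀⁻¹ * g * y₀ = x := by
    by_cases hq2 : q = 2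
    · set g' : G q := linGL η hη (0, 1) with hg'
      have hg'coe : (g' : Mat q) = η := by
        rw [hg', linGL_coe hη h01]
        simp [lin]
      have hmem : g' ∈ nonsplitTorus η := by
        rw [nonsplitTorus_eq_image hη]
        exact Finset.mem_image_of_mem _ (Finset.mem_erase.2 ⟨h01, Finset.mem_univ _⟩)
      have hg'ns : ¬ IsScalarMat (g' : Mat q) := by
        rw [hg'coe]
        exact fun hs => hη (hasRatEigenvalue_of_isScalarMat hs)
      obtain ⟨t1, d1⟩ := trace_det_of_two hq2 hη
      obtain ⟨t2, d2⟩ := trace_det_of_two hq2 hη'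
      obtain ⟨y₀, hy₀⟩ := exists_conj_units g g' hgns hg'ns (by rw [hgcoe, hg'coe, t1, t2]) (by rw [hgcoe, hg'coe, d1, d2])
      exact ⟨g', hmem, y₀, hy₀⟩
    · have hgell : ¬ HasRatEigenvalue (g : Mat q) := by
        rw [hgcoe]
        exact hη'
      have hcard := card_nonsplitTorus_conj_of_elliptic hq2 hη g hgell
      have hne : ((nonsplitTorus η).filter fun x => ∃ y : G q, y⁻¹ * g * y = x).Nonempty := by
        rw [← Finset.card_pos, hcard]
        norm_num
      obtain ⟨x, hx⟩ := hne
      rw [Finset.mem_filter] at hx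
      exact ⟨x, hx.1, hx.2⟩
  -- `x = a·1 + b·η` with `b ≠ 0`
  rw [nonsplitTorus_eq_image hη] at hxT
  obtain ⟨p₀, hp₀, rfl⟩ := Finset.mem_image.1 hxT
  have hp₀0 : p₀ ≠ 0 := (Finset.mem_erase.1 hp₀).1
  have hxcoe : ((linGL η hη p₀ : G q) : Mat q) = lin η p₀ := linGL_coe hη hp₀0
  have hp₀2 : p₀.2 ≠ 0 := by
    intro h2
    have hs : IsScalarMat ((linGL η hη p₀ : G q) : Mat q) := by
      rw [hxcoe]
      exact (isScalarMat_lin_iff hη p₀).2 h2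
    rw [← hy₀, isScalarMat_conj] at hs
    exact hgns hs
  have hconj : ((y₀⁻¹ : G q) : Mat q) * η' * (y₀ : Mat q) = lin η p₀ := by
    have h := congrArg (fun z : G q => (z : Mat q)) hy₀
    simpa only [Units.val_mul, hgcoe, hxcoe] using h
  -- step 3: correct the determinant inside `T_η`
  obtain ⟨pc, hpc0, hpc⟩ := exists_lin_det_eq hη (inv_ne_zero (CubicClasses.det_ne_zero y₀))
  set c : G q := linGL η hη pc with hc
  have hccoe : (c : Mat q) = lin η pc := linGL_coe hη hpc0
  refine ⟨y₀ * c, ?_, p₀, hp₀2, ?_⟩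
  · rw [Units.val_mul, Matrix.det_mul, hccoe, hpc, mul_inv_cancel₀ (CubicClasses.det_ne_zero y₀)]
  · have hcinv : ((c⁻¹ : G q) : Mat q) * (c : Mat q) = 1 := by
      rw [← Units.val_mul, inv_mul_cancel, Units.val_one]
    calc (((y₀ * c)⁻¹ : G q) : Mat q) * η' * ((y₀ * c : G q) : Mat q)
        = ((c⁻¹ : G q) : Mat q) * (((y₀⁻¹ : G q) : Mat q) * η' * (y₀ : Mat q)) * (c : Mat q) := by
          rw [mul_inv_rev, Units.val_mul, Units.val_mul]
          noncomm_ring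
      _ = ((c⁻¹ : G q) : Mat q) * (c : Mat q) * lin η p₀ := by rw [hconj, hccoe, mul_assoc, lin_mul_comm, ← mul_assoc]
      _ = lin η p₀ := by rw [hcinv, one_mul]

/-! ## §4 Conjugating the whole field `𝔽_q[η']` onto `𝔽_q[η]` -/

/-- PROVED: conjugation fixes scalars — `A (a·1 + b·η) B = a·1 + b·(A η B)` when `A B = 1`. [folklore] -/
theorem conj_lin (A B : Mat q) (h : A * B = 1) (η : Mat q) (p : ZMod q × ZMod q) :
    A * lin η p * B = lin (A * η * B) p := by
  simp only [lin, mul_add, add_mul, Matrix.mul_smul, Matrix.smul_mul, Matrix.mul_one, h]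

/-- PROVED: `𝔽_q[a·1 + b·η] ⊆ 𝔽_q[η]`: `a'·1 + b'·(a·1 + b·η) = (a' + b'a)·1 + (b'b)·η`. [folklore] -/
theorem lin_lin (η : Mat q) (p₀ p : ZMod q × ZMod q) :
    lin (lin η p₀) p = lin η (p.1 + p.2 * p₀.1, p.2 * p₀.2) := by
  simp only [lin, smul_add, smul_smul, add_smul]
  abel

/-- PROVED — **`y⁻¹ 𝔽_q[η'] y = 𝔽_q[η]` with `det y = 1`**: for `η, η'` without rational eigenvalue there is `y ∈ GL₂(𝔽_q)` of determinant `1` such that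
`y⁻¹ (a·1 + b·η') y ∈ 𝔽_q[η]` for all `(a, b)` and `y (a·1 + b·η) y⁻¹ ∈ 𝔽_q[η']` for all `(a, b)` (from §3: `y⁻¹ η' y = a₀·1 + b₀·η` with `b₀ ≠ 0`,
so `y η y⁻¹ = b₀⁻¹·(η' − a₀·1)`). [folklore] -/
theorem exists_det_one_conj_field {η η' : Mat q} (hη : ¬ HasRatEigenvalue η) (hη' : ¬ HasRatEigenvalue η') :
    ∃ y : G q, (y : Mat q).det = 1 ∧
      (∀ p : ZMod q × ZMod q, ∃ p' : ZMod q × ZMod q, ((y⁻¹ : G q) : Mat q) * lin η' p * (y : Mat q) = lin η p') ∧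
      (∀ p' : ZMod q × ZMod q, ∃ p : ZMod q × ZMod q, (y : Mat q) * lin η p' * ((y⁻¹ : G q) : Mat q) = lin η' p) := by
  obtain ⟨y, hy, p₀, hp₀2, hconj⟩ := exists_det_one_conj_eq_lin hη hη'
  have hyinv : (y : Mat q) * ((y⁻¹ : G q) : Mat q) = 1 := by rw [← Units.val_mul, mul_inv_cancel, Units.val_one]
  have hyinv' : ((y⁻¹ : G q) : Mat q) * (y : Mat q) = 1 := by rw [← Units.val_mul, inv_mul_cancel, Units.val_one]
  -- `y η y⁻¹ = b₀⁻¹ · (η' − a₀·1)`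
  have h1 : (y : Mat q) * lin η p₀ * ((y⁻¹ : G q) : Mat q) = η' := by
    rw [← hconj]
    calc (y : Mat q) * (((y⁻¹ : G q) : Mat q) * η' * (y : Mat q)) * ((y⁻¹ : G q) : Mat q)
        = ((y : Mat q) * ((y⁻¹ : G q) : Mat q)) * η' * ((y : Mat q) * ((y⁻¹ : G q) : Mat q)) := by noncomm_ring
      _ = η' := by rw [hyinv, one_mul, mul_one]
  have h2 : (y : Mat q) * η * ((y⁻¹ : G q) : Mat q) = lin η' (-(p₀.1 * p₀.2⁻¹), p₀.2⁻¹) := by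
    rw [conj_lin _ _ hyinv] at h1
    have h3 : (y : Mat q) * η * ((y⁻¹ : G q) : Mat q) = p₀.2⁻¹ • (η' - p₀.1 • (1 : Mat q)) := by
      rw [← h1, lin, add_sub_cancel_left, smul_smul, inv_mul_cancel₀ hp₀2, one_smul]
    rw [h3, lin, smul_sub, smul_smul, neg_smul, mul_comm]
    abel
  refine ⟨y, hy, fun p => ⟨(p.1 + p.2 * p₀.1, p.2 * p₀.2), ?_⟩,
    fun p' => ⟨(p'.1 + p'.2 * (-(p₀.1 * p₀.2⁻¹)), p'.2 * p₀.2⁻¹), ?_⟩⟩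
  · rw [conj_lin _ _ hyinv', hconj, lin_lin]
  · rw [conj_lin _ _ hyinv, h2, lin_lin]

/-- PROVED — **MEMBERSHIP TRANSPORT** (the form consumed by the pinning step): with `y` as in `exists_det_one_conj_field`, a matrix `m` lies in
`𝔽_q[η']` iff `y⁻¹ m y` lies in `𝔽_q[η]`. [folklore] -/
theorem conj_mem_field_iff {η η' : Mat q} {y : G q}
    (hfwd : ∀ p : ZMod q × ZMod q, ∃ p' : ZMod q × ZMod q, ((y⁻¹ : G q) : Mat q) * lin η' p * (y : Mat q) = lin η p')
    (hbwd : ∀ p' : ZMod q × ZMod q, ∃ p : ZMod q × ZMod q, (y : Mat q) * lin η p' * ((y⁻¹ : G q) : Mat q) = lin η' p)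
    (m : Mat q) :
    (∃ p : ZMod q × ZMod q, m = lin η' p) ↔ ∃ p' : ZMod q × ZMod q, ((y⁻¹ : G q) : Mat q) * m * (y : Mat q) = lin η p' := by
  have hyinv : (y : Mat q) * ((y⁻¹ : G q) : Mat q) = 1 := by rw [← Units.val_mul, mul_inv_cancel, Units.val_one]
  constructor
  · rintro ⟨p, rfl⟩
    exact hfwd p
  · rintro ⟨p', hp'⟩
    obtain ⟨p, hp⟩ := hbwd p'
    refine ⟨p, ?_⟩
    rw [← hp, ← hp']
    calc m = ((y : Mat q) * ((y⁻¹ : G q) : Mat q)) * m * ((y : Mat q) * ((y⁻¹ : G q) : Mat q)) := by rw [hyinv, one_mul, mul_one]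
      _ = (y : Mat q) * (((y⁻¹ : G q) : Mat q) * m * (y : Mat q)) * ((y⁻¹ : G q) : Mat q) := by noncomm_ring

end Summit.BirchSwinnertonDyer.BirchSwinnertonDyer.Theorems.CartanTransport.ResidueField
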